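import Summits.HubbardSuperconductivity.HubbardSuperconductivity.Theorems.AnisotropyChordTransferFibre3N1Identity

/-!
# Route `AnisotropyChord` / H0 rotor rung: `G2OneLoopForm` (PartN33 Layer B) PROVED — `G₂ = T⁺‖Π⁰‖² + 12Δ f_nn² A(x̂)`

Memo 21 §297 (theory seat `hubbard-h0-rotor-theory-1`).  With `D(s) := Σ_c (Π⁰(c+s) − Π⁰(c))²` one has `G₂ = D(x̂,0) + D(0,x̂) + D(−x̂,−x̂)`,
`Σ_c Π⁰(c)·hop_e(c) = 3‖Π⁰‖² − ½[D(e,0) + D(0,e) + D(−e,−e)]` for each of the four directions, `D(−s) = D(s)` (translation) and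
`D(σs) = D(s)` for the coordinate swap `σ` when `f(y,x) = f(x,y)`; hence `Re⟨Π⁰,H₀⁰Π⁰⟩ = 6‖Π⁰‖² − ½·4·(3‖Π⁰‖² − ½G₂) = G₂`.
With `T⁺‖Π⁰‖² = Re⟨Π⁰,(H₀⁰ − ΔW)Π⁰⟩` and `Σ_c WΠ⁰² = 12 f_nn² A(x̂)` (the three pair indicators, `f` even, swap-symmetric, `L ≥ 3`
so that the four neighbours are distinct): **`g2OneLoopForm_holds (hL : 3 ≤ L) (Δ) : G2OneLoopForm L Δ`.**
Prover seat `hubbard-h0-rotor-p1` g22; helper for stmt-HubbardSuperconductivity-19089 (`--supports`).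
-/

set_option linter.dupNamespace false
set_option autoImplicit false

noncomputable section

open scoped BigOperators
open Complex

namespace Summit.HubbardSuperconductivity.HubbardSuperconductivity.Theorems.AnisotropyChord.Transfer.Fibre3

variable (L : ℕ) [NeZero L]

/-! ## Shift sums `D(s)` -/

/-- `D(s) := Σ_c (Π⁰(c + s) − Π⁰(c))²`. [folklore] -/
def Dsh (f : Tor L → ℝ) (s : Cfg L) : ℝ := ∑ c : Cfg L, (piR L f (c + s) - piR L f c) ^ 2

/-- `D(−s) = D(s)` (translation invariance). [folklore] -/
theorem Dsh_neg (f : Tor L → ℝ) (s : Cfg L) : Dsh L f (-s) = Dsh L f s := by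
  unfold Dsh
  rw [← Fintype.sum_equiv (Equiv.addRight s) (fun c => (piR L f c - piR L f (c + s)) ^ 2)
    (fun c => (piR L f (c + -s) - piR L f c) ^ 2)
    (fun c => by simp only [Equiv.coe_addRight, add_neg_cancel_right])]
  exact Finset.sum_congr rfl fun c _ => by ring

/-- the coordinate swap `x ↔ y` on configurations. [folklore] -/
def swapXY : Cfg L ≃ Cfg L := Equiv.prodCongr (Equiv.prodComm _ _) (Equiv.prodComm _ _)

omit [NeZero L] in
/-- [folklore] -/
theorem swapXY_apply (c : Cfg L) : swapXY L c = ((c.1.2, c.1.1), (c.2.2, c.2.1)) := rfl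

omit [NeZero L] in
/-- `σ` is additive. [folklore] -/
theorem swapXY_add (c s : Cfg L) : swapXY L (c + s) = swapXY L c + swapXY L s := by
  simp only [swapXY_apply, Prod.fst_add, Prod.snd_add, Prod.mk_add_mk]

omit [NeZero L] in
/-- `Π⁰ ∘ σ = Π⁰` for a swap-symmetric `f`. [folklore] -/
theorem piR_swapXY {f : Tor L → ℝ} (hsw : ∀ r : Tor L, f (r.2, r.1) = f r) (c : Cfg L) :
    piR L f (swapXY L c) = piR L f c := by
  unfold piR
  rw [swapXY_apply]
  simp only
  have h3 : f ((c.2.2, c.2.1) - (c.1.2, c.1.1)) = f (c.2 - c.1) := by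
    rw [← hsw (c.2 - c.1)]; rfl
  rw [hsw c.1, hsw c.2, h3]

/-- `D(σ s) = D(s)` for a swap-symmetric `f`. [folklore] -/
theorem Dsh_swapXY {f : Tor L → ℝ} (hsw : ∀ r : Tor L, f (r.2, r.1) = f r) (s : Cfg L) :
    Dsh L f (swapXY L s) = Dsh L f s := by
  unfold Dsh
  symm
  refine Fintype.sum_equiv (swapXY L) _ _ (fun c => ?_)
  rw [← piR_swapXY L hsw (c + s), ← piR_swapXY L hsw c, swapXY_add]

/-- `Σ_c Π⁰(c)·hop_e(c) = 3‖Π⁰‖² − ½[D(e,0) + D(0,e) + D(−e,−e)]`. [folklore] -/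
theorem sum_piR_hopR (f : Tor L → ℝ) (e : Tor L) :
    ∑ c : Cfg L, piR L f c * hopR L f c e
      = 3 * PiNormSq L f - (1 / 2) * (Dsh L f (e, 0) + Dsh L f (0, e) + Dsh L f (-e, -e)) := by
  have e1 : ∀ c : Cfg L, piR L f (c.1 + e, c.2) = piR L f (c + (e, 0)) := by
    intro c; unfold piR; simp only [Prod.fst_add, Prod.snd_add, add_zero]
  have e2 : ∀ c : Cfg L, piR L f (c.1, c.2 + e) = piR L f (c + (0, e)) := by
    intro c; unfold piR; simp only [Prod.fst_add, Prod.snd_add, add_zero]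
  have e3 : ∀ c : Cfg L, piR L f (c.1 - e, c.2 - e) = piR L f (c + (-e, -e)) := by
    intro c; unfold piR; simp only [Prod.fst_add, Prod.snd_add, ← sub_eq_add_neg]
  unfold hopR Dsh
  simp only [e1, e2, e3, mul_add, Finset.sum_add_distrib, sum_piR_mul_shift]
  ring

/-- `G₂ = D(x̂,0) + D(0,x̂) + D(−x̂,−x̂)`. [folklore] -/
theorem G2term_eq_Dsh (f : Tor L → ℝ) :
    G2term L f = Dsh L f (K1 L, 0) + Dsh L f (0, K1 L) + Dsh L f (-K1 L, -K1 L) := by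
  unfold G2term Dsh
  rw [← Finset.sum_add_distrib, ← Finset.sum_add_distrib]
  refine Finset.sum_congr rfl fun c _ => ?_
  have e1 : piR L f (c + (K1 L, 0)) = piR L f (c.1 + K1 L, c.2) := by
    unfold piR; simp only [Prod.fst_add, Prod.snd_add, add_zero]
  have e2 : piR L f (c + (0, K1 L)) = piR L f (c.1, c.2 + K1 L) := by
    unfold piR; simp only [Prod.fst_add, Prod.snd_add, add_zero]
  have e3 : piR L f (c + (-K1 L, -K1 L)) = piR L f (c.1 - K1 L, c.2 - K1 L) := by
    unfold piR; simp only [Prod.fst_add, Prod.snd_add, ← sub_eq_add_neg]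
  rw [e1, e2, e3]

/-- the four hop sums are all equal to `3‖Π⁰‖² − ½G₂` (swap-symmetric `f`). [folklore] -/
theorem sum_piR_hopR_four {f : Tor L → ℝ} (hsw : ∀ r : Tor L, f (r.2, r.1) = f r) :
    ∑ c : Cfg L, piR L f c * hopR L f c (ex L) = 3 * PiNormSq L f - (1 / 2) * G2term L f ∧
    ∑ c : Cfg L, piR L f c * hopR L f c (-ex L) = 3 * PiNormSq L f - (1 / 2) * G2term L f ∧
    ∑ c : Cfg L, piR L f c * hopR L f c (ey L) = 3 * PiNormSq L f - (1 / 2) * G2term L f ∧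
    ∑ c : Cfg L, piR L f c * hopR L f c (-ey L) = 3 * PiNormSq L f - (1 / 2) * G2term L f := by
  have hG := G2term_eq_Dsh L f
  have hK : K1 L = ex L := rfl
  rw [hK] at hG
  -- the `x̂` shifts, their negatives and their swaps
  have n1 : ((-ex L, 0) : Cfg L) = -(ex L, 0) := by simp
  have n2 : ((0, -ex L) : Cfg L) = -(0, ex L) := by simp
  have n3 : ((- -ex L, - -ex L) : Cfg L) = -(-ex L, -ex L) := by simp
  have s1 : swapXY L (ex L, 0) = (ey L, 0) := rfl
  have s2 : swapXY L (0, ex L) = (0, ey L) := rfl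
  have s3 : swapXY L (-ex L, -ex L) = (-ey L, -ey L) := by
    rw [swapXY_apply]; unfold ex ey; simp
  have m1 : ((-ey L, 0) : Cfg L) = -(ey L, 0) := by simp
  have m2 : ((0, -ey L) : Cfg L) = -(0, ey L) := by simp
  have m3 : ((- -ey L, - -ey L) : Cfg L) = -(-ey L, -ey L) := by simp
  refine ⟨?_, ?_, ?_, ?_⟩
  · rw [sum_piR_hopR, hG]
  · rw [sum_piR_hopR, hG, n1, n2, n3, Dsh_neg, Dsh_neg, Dsh_neg]
  · rw [sum_piR_hopR, hG, ← s1, ← s2, ← s3, Dsh_swapXY L hsw, Dsh_swapXY L hsw, Dsh_swapXY L hsw]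
  · rw [sum_piR_hopR, hG, m1, m2, m3, Dsh_neg, Dsh_neg, Dsh_neg, ← s1, ← s2, ← s3, Dsh_swapXY L hsw,
      Dsh_swapXY L hsw, Dsh_swapXY L hsw]

/-- **`Re⟨Π⁰, H₀⁰Π⁰⟩ = G₂`** (swap-symmetric `f`). [folklore] -/
theorem re_ip_prodState_H0apply {f : Tor L → ℝ} (hsw : ∀ r : Tor L, f (r.2, r.1) = f r) :
    (ip L (prodState L f) (H0apply L 0 (prodState L f))).re = G2term L f := by
  obtain ⟨h1, h2, h3, h4⟩ := sum_piR_hopR_four L hsw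
  have hre : (ip L (prodState L f) (H0apply L 0 (prodState L f))).re
      = ∑ c : Cfg L, piR L f c * (H0apply L 0 (prodState L f) c).re := by
    unfold ip
    rw [Complex.re_sum]
    refine Finset.sum_congr rfl fun c _ => ?_
    rw [prodState_eq_piR, Complex.conj_ofReal, Complex.re_ofReal_mul]
  have hpt : ∀ c : Cfg L, piR L f c * (H0apply L 0 (prodState L f) c).re
      = 6 * piR L f c ^ 2 - (1 / 2) * (piR L f c * hopR L f c (ex L) + piR L f c * hopR L f c (-ex L)
          + piR L f c * hopR L f c (ey L) + piR L f c * hopR L f c (-ey L)) := by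
    intro c
    rw [H0apply_zero_prodState_re L 0, Happly_zero_prodState_re]
    ring
  rw [hre, Finset.sum_congr rfl fun c _ => hpt c, Finset.sum_sub_distrib, ← Finset.mul_sum, ← Finset.mul_sum,
    Finset.sum_add_distrib, Finset.sum_add_distrib, Finset.sum_add_distrib, h1, h2, h3, h4]
  unfold PiNormSq
  ring

/-! ## `T⁺‖Π⁰‖²` and the contact weight -/

/-- `T⁺‖Π⁰‖² = Re⟨Π⁰, HΠ⁰⟩` (also when `Π⁰ ≡ 0`). [folklore] -/
theorem Tplus_mul_PiNormSq (Δ : ℝ) (f : Tor L → ℝ) :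
    Tplus L Δ f * PiNormSq L f = (ip L (prodState L f) (Happly L 0 Δ (prodState L f))).re := by
  have hP : PiNormSq L f = ∑ c : Cfg L, piR L f c ^ 2 := rfl
  unfold Tplus RQ
  rw [← PiNormSq_eq_ip]
  by_cases hz : PiNormSq L f = 0
  · have hpi : ∀ c : Cfg L, piR L f c = 0 := by
      intro c
      have h := (Finset.sum_eq_zero_iff_of_nonneg (fun x _ => sq_nonneg (piR L f x))).mp (hP ▸ hz) c (Finset.mem_univ c)
      exact pow_eq_zero_iff (two_ne_zero) |>.mp h
    rw [hz, mul_zero, re_ip_prodState_Happly]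
    symm
    exact Finset.sum_eq_zero fun c _ => by rw [hpi c, zero_mul]
  · field_simp

/-- `Σ_a 1_NN(a) h(a) = h(x̂) + h(−x̂) + h(ŷ) + h(−ŷ)` (`L ≥ 3`). [folklore] -/
theorem sum_ite_isNN (hL : 3 ≤ L) (h : Tor L → ℝ) :
    ∑ a : Tor L, (if IsNN L a then h a else 0) = h (ex L) + h (-ex L) + h (ey L) + h (-ey L) := by
  classical
  obtain ⟨d1, d2, d3, d4, d5, d6⟩ := nn_distinct L hL
  rw [← Finset.sum_filter, filter_isNN, Finset.sum_insert (by simp [d1, d2, d3]), Finset.sum_insert (by simp [d4, d5]),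
    Finset.sum_insert (by simp [d6]), Finset.sum_singleton]
  ring

/-- the contact correlation in direction `e`: `A(e) := Σ_b f(b)² f(b − e)²`. [folklore] -/
def Acorr (f : Tor L → ℝ) (e : Tor L) : ℝ := ∑ b : Tor L, f b ^ 2 * f (b - e) ^ 2

/-- `A(−e) = A(e)` (translation). [folklore] -/
theorem Acorr_neg (f : Tor L → ℝ) (e : Tor L) : Acorr L f (-e) = Acorr L f e := by
  unfold Acorr
  refine Fintype.sum_equiv (Equiv.addRight e) _ _ (fun b => ?_)
  simp only [Equiv.coe_addRight, add_sub_cancel_right, sub_neg_eq_add]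
  ring

/-- `A(ŷ) = A(x̂)` for a swap-symmetric `f`. [folklore] -/
theorem Acorr_ey {f : Tor L → ℝ} (hsw : ∀ r : Tor L, f (r.2, r.1) = f r) : Acorr L f (ey L) = Acorr L f (ex L) := by
  unfold Acorr
  refine Fintype.sum_equiv (Equiv.prodComm _ _) _ _ (fun b => ?_)
  simp only [Equiv.prodComm_apply, Prod.swap]
  rw [← hsw b, ← hsw (b - ey L)]
  congr 2

/-- `A(e) = A(x̂)` for each of the four neighbours (swap-symmetric `f`). [folklore] -/
theorem Acorr_nn {f : Tor L → ℝ} (hsw : ∀ r : Tor L, f (r.2, r.1) = f r) :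
    Acorr L f (ex L) = Axhat L f ∧ Acorr L f (-ex L) = Axhat L f ∧ Acorr L f (ey L) = Axhat L f ∧
      Acorr L f (-ey L) = Axhat L f := by
  have h0 : Acorr L f (ex L) = Axhat L f := rfl
  refine ⟨h0, ?_, ?_, ?_⟩
  · rw [Acorr_neg, h0]
  · rw [Acorr_ey L hsw, h0]
  · rw [Acorr_neg, Acorr_ey L hsw, h0]

/-- the first-particle contact weight: `Σ_c 1_NN(a) Π⁰(c)² = 4 f_nn² A(x̂)`. [folklore] -/
theorem sum_nn_fst (hL : 3 ≤ L) {Δ lam2 : ℝ} {f : Tor L → ℝ} (hf : IsTwoMagnon L Δ lam2 f)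
    (hsw : ∀ r : Tor L, f (r.2, r.1) = f r) :
    ∑ c : Cfg L, (if IsNN L c.1 then (1 : ℝ) else 0) * piR L f c ^ 2 = 4 * f (K1 L) ^ 2 * Axhat L f := by
  have hnn := hf.2.1
  have f1 : f (ex L) = f (K1 L) := hnn _ (by unfold nnList ex; simp)
  have f2 : f (-ex L) = f (K1 L) := hnn _ (by rw [← neg_ex]; unfold nnList; simp)
  have f3 : f (ey L) = f (K1 L) := hnn _ (by unfold nnList ey; simp)
  have f4 : f (-ey L) = f (K1 L) := hnn _ (by rw [← neg_ey]; unfold nnList; simp)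
  obtain ⟨a1, a2, a3, a4⟩ := Acorr_nn L hsw
  rw [Fintype.sum_prod_type]
  have hrow : ∀ a : Tor L, ∑ b : Tor L, (if IsNN L (a, b).1 then (1 : ℝ) else 0) * piR L f (a, b) ^ 2
      = if IsNN L a then f a ^ 2 * Acorr L f a else 0 := by
    intro a
    split_ifs with ha
    · unfold Acorr piR; rw [Finset.mul_sum]; refine Finset.sum_congr rfl fun b _ => ?_; simp only; ring
    · simp
  rw [Finset.sum_congr rfl fun a _ => hrow a, sum_ite_isNN L hL, f1, f2, f3, f4, a1, a2, a3, a4]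
  ring

/-- the second-particle weight equals the first (swap `2 ↔ 3`, `f` even). [folklore] -/
theorem sum_nn_snd {f : Tor L → ℝ} (hev : ∀ r : Tor L, f (-r) = f r) :
    ∑ c : Cfg L, (if IsNN L c.2 then (1 : ℝ) else 0) * piR L f c ^ 2
      = ∑ c : Cfg L, (if IsNN L c.1 then (1 : ℝ) else 0) * piR L f c ^ 2 := by
  refine Fintype.sum_equiv (Equiv.prodComm _ _) _ _ (fun c => ?_)
  simp only [Equiv.prodComm_apply, Prod.swap]
  unfold piR
  rw [show c.1 - c.2 = -(c.2 - c.1) by abel, hev]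
  ring

/-- the pair `2–3` reparametrisation `(a, b) ↦ (a, b − a)`. [folklore] -/
def relEquiv : Cfg L ≃ Cfg L where
  toFun c := (c.1, c.2 - c.1)
  invFun c := (c.1, c.2 + c.1)
  left_inv c := by simp
  right_inv c := by simp

/-- the third-pair weight: `Σ_c 1_NN(b − a) Π⁰(c)² = 4 f_nn² A(x̂)`. [folklore] -/
theorem sum_nn_rel (hL : 3 ≤ L) {Δ lam2 : ℝ} {f : Tor L → ℝ} (hf : IsTwoMagnon L Δ lam2 f)
    (hsw : ∀ r : Tor L, f (r.2, r.1) = f r) :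
    ∑ c : Cfg L, (if IsNN L (c.2 - c.1) then (1 : ℝ) else 0) * piR L f c ^ 2 = 4 * f (K1 L) ^ 2 * Axhat L f := by
  have hnn := hf.2.1
  have f1 : f (ex L) = f (K1 L) := hnn _ (by unfold nnList ex; simp)
  have f2 : f (-ex L) = f (K1 L) := hnn _ (by rw [← neg_ex]; unfold nnList; simp)
  have f3 : f (ey L) = f (K1 L) := hnn _ (by unfold nnList ey; simp)
  have f4 : f (-ey L) = f (K1 L) := hnn _ (by rw [← neg_ey]; unfold nnList; simp)
  obtain ⟨a1, a2, a3, a4⟩ := Acorr_nn L hsw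
  -- reparametrise by `(a, c') = (a, b − a)`
  rw [Fintype.sum_equiv (relEquiv L) (fun c : Cfg L => (if IsNN L (c.2 - c.1) then (1 : ℝ) else 0) * piR L f c ^ 2)
    (fun d : Cfg L => (if IsNN L d.2 then (1 : ℝ) else 0) * (f d.1 * f (d.2 + d.1) * f d.2) ^ 2)
    (fun c => by simp only [relEquiv, Equiv.coe_fn_mk, sub_add_cancel, piR]; all_goals (split_ifs <;> ring))]
  rw [Fintype.sum_prod_type, Finset.sum_comm]
  have hrow : ∀ c' : Tor L, ∑ a : Tor L, (if IsNN L (a, c').2 then (1 : ℝ) else 0) * (f (a, c').1 * f ((a, c').2 + (a, c').1) * f (a, c').2) ^ 2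
      = if IsNN L c' then f c' ^ 2 * Acorr L f (-c') else 0 := by
    intro c'
    split_ifs with hc
    · unfold Acorr; rw [Finset.mul_sum]; refine Finset.sum_congr rfl fun a _ => ?_
      simp only [sub_neg_eq_add, add_comm c' a]; ring
    · simp
  rw [Finset.sum_congr rfl fun c' _ => hrow c', sum_ite_isNN L hL, neg_neg, neg_neg, f1, f2, f3, f4, a1, a2, a3, a4]
  ring

/-- **`Σ_c W(c) Π⁰(c)² = 12 f_nn² A(x̂)`** (`L ≥ 3`, `f` even and swap-symmetric). [folklore] -/
theorem sum_W_piR_sq (hL : 3 ≤ L) {Δ lam2 : ℝ} {f : Tor L → ℝ} (hf : IsTwoMagnon L Δ lam2 f)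
    (hev : ∀ r : Tor L, f (-r) = f r) (hsw : ∀ r : Tor L, f (r.2, r.1) = f r) :
    ∑ c : Cfg L, (Wcount L c : ℝ) * piR L f c ^ 2 = 12 * f (K1 L) ^ 2 * Axhat L f := by
  have h1 := sum_nn_fst L hL hf hsw
  have h2 := sum_nn_snd L hev
  have h3 := sum_nn_rel L hL hf hsw
  have hW : ∀ c : Cfg L, (Wcount L c : ℝ) * piR L f c ^ 2
      = (if IsNN L c.1 then (1 : ℝ) else 0) * piR L f c ^ 2 + (if IsNN L c.2 then (1 : ℝ) else 0) * piR L f c ^ 2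
        + (if IsNN L (c.2 - c.1) then (1 : ℝ) else 0) * piR L f c ^ 2 := by
    intro c; unfold Wcount; push_cast; ring
  rw [Finset.sum_congr rfl fun c _ => hW c, Finset.sum_add_distrib, Finset.sum_add_distrib, h2, h1, h3]
  ring

/-! ## The theorem -/

/-- ★ **`G2OneLoopForm L Δ` holds** (`L ≥ 3`). [folklore] -/
theorem g2OneLoopForm_holds (hL : 3 ≤ L) (Δ : ℝ) : G2OneLoopForm L Δ := by
  intro lam2 f hf hev hsw
  have hT := Tplus_mul_PiNormSq L Δ f
  rw [re_ip_Happly, re_ip_prodState_H0apply L hsw] at hT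
  have hW := sum_W_piR_sq L hL hf hev hsw
  have hn : ∀ c : Cfg L, (Wcount L c : ℝ) * ‖prodState L f c‖ ^ 2 = (Wcount L c : ℝ) * piR L f c ^ 2 := by
    intro c; rw [prodState_eq_piR, Complex.norm_real, Real.norm_eq_abs, sq_abs]
  rw [Finset.sum_congr rfl fun c _ => hn c, hW] at hT
  linarith

end Summit.HubbardSuperconductivity.HubbardSuperconductivity.Theorems.AnisotropyChord.Transfer.Fibre3

end
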